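import Summits.RiemannHypothesis.RiemannHypothesis.Theses.WeilComb
import Summits.RiemannHypothesis.RiemannHypothesis.Theorems.WeilCombCombShapePositivityArchOffdiagBounds
import Literature.NumberTheory.LFunctions.WeilExplicit
import Literature.NumberTheory.LFunctions.WeilExplicitProofs
import Literature.NumberTheory.LFunctions.WeilMellinBounds
import Literature.NumberTheory.LFunctions.WeilWindowSimpleEven

/-!
# The signed archimedean off-diagonal form of the fixed-shape comb
(crux `WeilComb.CombShapePositivity`, item stmt-RiemannHypothesis-11229, line `Sketch`; stub
`stub_subOffdiag` of the effective subcritical window `stub_windowSub`)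

Notation: `φ₀(u) = expNegInvGlue (1 - u²)` (the route's fixed bump), `φ_ε(t) = ε⁻¹ φ₀(t/ε)`,
`ψ_ε = φ_ε ⋆ φ̃_ε` (`weilConv` / `weilReflect`), `τ_x h = weilTranslate h x = h(· − x)`,
`W_∞ = weilArchTerm`, `g(t) = e^{t/2}/(2 sinh t)`, `I₀ = ∫ φ₀`,
`B_abs(a) = Σ_{m ≠ m'} ‖a_m‖ ‖a_{m'}‖ / |log m − log m'|`, `S₁ = Σ ‖a_m‖` (sums over `1 ≤ m, m' ≤ M`).

**Statement.** For `ε > 0`, `M`, `a` with `4εM ≤ 1`: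
`−I₀² (B_abs(a) + S₁²) ≤ Re Σ_m Σ_{m' ≠ m} a_m conj a_{m'} W_∞(τ_{log m − log m'} ψ_ε)`.

**Proof.**
* Log gap: for `m ≠ m'` in `[1, M]`, `|log m − log m'| ≥ 1 − m'/m ≥ 1/M ≥ 4ε`
  (`Real.one_sub_inv_le_log_of_pos`), so with `x = log m − log m'`, `|x| − 2ε ≥ |x|/2 > 0`.
* Evenness: `ψ_ε` is real (`φ_ε` is) and self-adjoint, hence even, so `τ_{−x} ψ_ε = (τ_x ψ_ε)(−·)`
  and `W_∞(τ_{−x} ψ_ε) = W_∞(τ_x ψ_ε)` by the hypothesis-free reflection invariance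
  `weilArchTerm_comp_neg`; thus every entry is `W_∞(τ_{|x|} ψ_ε)` with `|x| > 2ε`.
* Brackets (`weilArchTerm_translate_psi_offdiag_bounds`, p93560): `W_∞(τ_{|x|} ψ_ε)` is real and
  lies in `[−I₀² g(|x| − 2ε), −I₀² g(|x| + 2ε)] ⊂ [−I₀² g(|x| − 2ε), 0]`.
* The weight: `g(t) ≤ 1/(2t) + 1` for `t > 0` (`(1 + 2t)(e^t − e^{−t}) ≥ 2t e^t ≥ 2t e^{t/2}`
  from `1 + 2t ≤ e^{2t}`), so `g(|x| − 2ε) ≤ 1/(2(|x| − 2ε)) + 1 ≤ 1/|x| + 1`.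
* Entrywise `Re(a_m conj a_{m'} w) ≥ −|w| ‖a_m‖ ‖a_{m'}‖ ≥ −I₀² (1/|x| + 1) ‖a_m‖ ‖a_{m'}‖`; summing
  over ordered pairs `m ≠ m'` and `Σ_{m ≠ m'} ‖a_m‖ ‖a_{m'}‖ ≤ S₁²` gives the claim.
-/

noncomputable section

-- the sub-problem path RiemannHypothesis/RiemannHypothesis duplicates a namespace (D-0017)
set_option linter.dupNamespace false

open scoped BigOperators ComplexConjugate
open Complex MeasureTheory

namespace Summit.RiemannHypothesis.RiemannHypothesis.Theorems.WeilCombBohrFejer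

open Literature.NumberTheory.LFunctions

/-! ### Private toolkit: evenness of the archimedean symbol of a real autocorrelation -/

/-- The autocorrelation `φ ⋆ φ̃` of a real-valued `φ` is real-valued:
`conj (φ ⋆ φ̃)(s) = ∫ conj φ(u) · φ(u − s) du = (φ ⋆ φ̃)(s)` (`integral_conj`). -/
private theorem conj_weilConv_weilReflect_of_real_subOffdiag {φ : ℝ → ℂ}
    (hreal : ∀ t, conj (φ t) = φ t) (s : ℝ) :
    conj (weilConv φ (weilReflect φ) s) = weilConv φ (weilReflect φ) s := by
  -- adapted from `WeilCombBohrFejer.conj_weilConv_weilReflect_of_real` (private, SymbolRealEven file)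
  rw [weilConv_apply, ← integral_conj]
  congr 1 with u
  simp only [weilReflect, map_mul, hreal]

/-- The autocorrelation `φ ⋆ φ̃` of a real-valued `φ` is even (real and self-adjoint,
`conj_weilConv_weilReflect_neg`). -/
private theorem weilConv_weilReflect_neg_of_real_subOffdiag {φ : ℝ → ℂ}
    (hreal : ∀ t, conj (φ t) = φ t) (s : ℝ) :
    weilConv φ (weilReflect φ) (-s) = weilConv φ (weilReflect φ) s := by
  -- adapted from `WeilCombBohrFejer.weilConv_weilReflect_neg_of_real` (private, SymbolRealEven file)
  rw [← conj_weilConv_weilReflect_of_real_subOffdiag hreal (-s)]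
  exact conj_weilConv_weilReflect_neg φ s

/-- For an even kernel `ψ`, `τ_{−x} ψ = (τ_x ψ)(−·)`. -/
private theorem weilTranslate_neg_of_even_subOffdiag {ψ : ℝ → ℂ} (heven : ∀ s, ψ (-s) = ψ s)
    (x : ℝ) : weilTranslate ψ (-x) = fun t => weilTranslate ψ x (-t) := by
  -- adapted from `WeilCombBohrFejer.weilTranslate_neg_of_even` (private, SymbolRealEven file)
  funext t
  simp only [weilTranslate]
  rw [← heven (t - -x)]
  congr 1
  ring

/-- For a real-valued `φ` and `ψ = φ ⋆ φ̃`: `W_∞(τ_{−x} ψ) = W_∞(τ_x ψ)` (`ψ` is even, so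
`τ_{−x} ψ = (τ_x ψ)(−·)`, and `W_∞` is reflection invariant, `weilArchTerm_comp_neg`). -/
private theorem weilArchTerm_weilTranslate_neg_of_real {φ : ℝ → ℂ}
    (hreal : ∀ t, conj (φ t) = φ t) (x : ℝ) :
    weilArchTerm (weilTranslate (weilConv φ (weilReflect φ)) (-x)) =
      weilArchTerm (weilTranslate (weilConv φ (weilReflect φ)) x) := by
  rw [weilTranslate_neg_of_even_subOffdiag (weilConv_weilReflect_neg_of_real_subOffdiag hreal),
    weilArchTerm_comp_neg]

/-! ### Private toolkit: elementary inequalities -/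

/-- The weight bound `e^{t/2}/(2 sinh t) ≤ 1/(2t) + 1` for `t > 0`:
`(1 + 2t)(e^t − e^{−t}) = e^t (1 + 2t)(1 − e^{−2t}) ≥ 2t e^t ≥ 2t e^{t/2}` since `(1 + 2t) e^{−2t} ≤ 1`. -/
private theorem archWeight_le_subOffdiag {t : ℝ} (ht : 0 < t) :
    Real.exp (t / 2) / (2 * Real.sinh t) ≤ 1 / (2 * t) + 1 := by
  have h2t : (0 : ℝ) < 2 * t := by positivity
  have hs : 0 < 2 * Real.sinh t := mul_pos two_pos (Real.sinh_pos_iff.2 ht)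
  have hA : (1 + 2 * t) * Real.exp (-(2 * t)) ≤ 1 := by
    have h1 : 2 * t + 1 ≤ Real.exp (2 * t) := Real.add_one_le_exp _
    have h2 : Real.exp (2 * t) * Real.exp (-(2 * t)) = 1 := by
      rw [← Real.exp_add, add_neg_cancel, Real.exp_zero]
    nlinarith [Real.exp_pos (-(2 * t))]
  have hB : Real.exp (-t) = Real.exp t * Real.exp (-(2 * t)) := by
    rw [← Real.exp_add]
    ring_nf
  have hC : Real.exp (t / 2) ≤ Real.exp t := Real.exp_le_exp.2 (by linarith)
  have hD : 0 ≤ Real.exp t * (1 - (1 + 2 * t) * Real.exp (-(2 * t))) :=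
    mul_nonneg (Real.exp_pos t).le (sub_nonneg.2 hA)
  have hE : 2 * t * Real.exp (t / 2) ≤ 2 * t * Real.exp t := mul_le_mul_of_nonneg_left hC h2t.le
  rw [show 1 / (2 * t) + 1 = (1 + 2 * t) / (2 * t) by field_simp, div_le_div_iff₀ hs h2t,
    Real.sinh_eq, hB]
  nlinarith [hD, hE]

/-- Log gap on `[1, M]`: for naturals `1 ≤ p < q ≤ M`, `1/M ≤ log q − log p`
(`log (q/p) ≥ 1 − p/q = (q − p)/q ≥ 1/q`). -/
private theorem log_gap_aux_subOffdiag {p q M : ℕ} (hp : 1 ≤ p) (hpq : p < q) (hqM : q ≤ M) :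
    1 / (M : ℝ) ≤ Real.log q - Real.log p := by
  have hp0 : (0 : ℝ) < p := by exact_mod_cast hp
  have hpq' : (p : ℝ) + 1 ≤ q := by exact_mod_cast hpq
  have hq0 : (0 : ℝ) < q := by linarith
  have hqM' : (q : ℝ) ≤ M := by exact_mod_cast hqM
  have hM0 : (0 : ℝ) < M := by linarith
  rw [← Real.log_div hq0.ne' hp0.ne']
  have h1 := Real.one_sub_inv_le_log_of_pos (div_pos hq0 hp0)
  rw [inv_div] at h1
  have h2 : 1 / (M : ℝ) ≤ 1 - p / q := by
    rw [div_le_iff₀ hM0, show 1 - (p : ℝ) / q = (q - p) / q by field_simp, div_mul_eq_mul_div,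
      le_div_iff₀ hq0]
    nlinarith
  linarith

/-- Log gap on `[1, M]`: for `m ≠ m'` in `Finset.Icc 1 M`, `1/M ≤ |log m − log m'|`. -/
private theorem log_gap_subOffdiag {m m' M : ℕ} (hm : m ∈ Finset.Icc 1 M)
    (hm' : m' ∈ (Finset.Icc 1 M).erase m) :
    1 / (M : ℝ) ≤ |Real.log m - Real.log m'| := by
  rw [Finset.mem_erase] at hm'
  rw [Finset.mem_Icc] at hm hm'
  rcases lt_or_gt_of_ne hm'.1 with h | h
  · rw [abs_of_pos (by linarith [log_gap_aux_subOffdiag hm'.2.1 h hm.2,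
      (one_div_pos.2 (by exact_mod_cast (lt_of_lt_of_le hm.1 hm.2) : (0 : ℝ) < M))])]
    exact log_gap_aux_subOffdiag hm'.2.1 h hm.2
  · rw [abs_sub_comm, abs_of_pos (by linarith [log_gap_aux_subOffdiag hm.1 h hm'.2.2,
      (one_div_pos.2 (by exact_mod_cast (lt_of_lt_of_le hm.1 hm.2) : (0 : ℝ) < M))])]
    exact log_gap_aux_subOffdiag hm.1 h hm'.2.2

/-- Entrywise: for `w` real with `|Re w| ≤ B`, `Re (z w) ≥ −B ‖z‖`. -/
private theorem re_mul_ge_of_real_subOffdiag {z w : ℂ} {B : ℝ} (him : w.im = 0)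
    (hw : |w.re| ≤ B) : -(B * ‖z‖) ≤ (z * w).re := by
  rw [Complex.mul_re, him, mul_zero, sub_zero]
  have h1 : |z.re * w.re| ≤ ‖z‖ * B := by
    rw [abs_mul]
    exact mul_le_mul (Complex.abs_re_le_norm z) hw (abs_nonneg _) (norm_nonneg _)
  have h2 := neg_abs_le (z.re * w.re)
  linarith [mul_comm B ‖z‖]

/-! ### The off-diagonal entries -/

/-- **Off-diagonal entries of the archimedean Gram matrix.** For `ε > 0` and `|x| ≥ 4ε`:
`W_∞(τ_x ψ_ε)` is real and `|Re W_∞(τ_x ψ_ε)| ≤ I₀² (1/|x| + 1)` (evenness reduces to `x = |x| > 2ε`;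
then p93560's brackets `[−I₀² g(|x| − 2ε), −I₀² g(|x| + 2ε)]` and `g(|x| − 2ε) ≤ 1/|x| + 1`). -/
theorem weilArchTerm_translate_psi_entry_bound : ∀ ε : ℝ, 0 < ε → ∀ x : ℝ, 4 * ε ≤ |x| →
    (weilArchTerm (weilTranslate
        (weilConv (fun t : ℝ => (ε : ℂ)⁻¹ * ((expNegInvGlue (1 - (t / ε) ^ 2) : ℝ) : ℂ))
          (weilReflect (fun t : ℝ => (ε : ℂ)⁻¹ * ((expNegInvGlue (1 - (t / ε) ^ 2) : ℝ) : ℂ)))) x)).im = 0 ∧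
    |(weilArchTerm (weilTranslate
        (weilConv (fun t : ℝ => (ε : ℂ)⁻¹ * ((expNegInvGlue (1 - (t / ε) ^ 2) : ℝ) : ℂ))
          (weilReflect (fun t : ℝ => (ε : ℂ)⁻¹ * ((expNegInvGlue (1 - (t / ε) ^ 2) : ℝ) : ℂ)))) x)).re| ≤
      (∫ u : ℝ, expNegInvGlue (1 - u ^ 2)) ^ 2 * (1 / |x| + 1) := by
  intro ε hε x hx
  have hx0 : 0 < |x| := lt_of_lt_of_le (by positivity) hx
  have h2 : 2 * ε < |x| := by linarith
  -- `φ_ε` is real-valued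
  have hreal : ∀ t : ℝ,
      conj ((ε : ℂ)⁻¹ * ((expNegInvGlue (1 - (t / ε) ^ 2) : ℝ) : ℂ)) =
        (ε : ℂ)⁻¹ * ((expNegInvGlue (1 - (t / ε) ^ 2) : ℝ) : ℂ) := by
    intro t
    simp only [map_mul, map_inv₀, Complex.conj_ofReal]
  -- reduce to `|x|` by evenness
  have heq : weilArchTerm (weilTranslate
        (weilConv (fun t : ℝ => (ε : ℂ)⁻¹ * ((expNegInvGlue (1 - (t / ε) ^ 2) : ℝ) : ℂ))
          (weilReflect (fun t : ℝ => (ε : ℂ)⁻¹ * ((expNegInvGlue (1 - (t / ε) ^ 2) : ℝ) : ℂ)))) x) =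
      weilArchTerm (weilTranslate
        (weilConv (fun t : ℝ => (ε : ℂ)⁻¹ * ((expNegInvGlue (1 - (t / ε) ^ 2) : ℝ) : ℂ))
          (weilReflect (fun t : ℝ => (ε : ℂ)⁻¹ * ((expNegInvGlue (1 - (t / ε) ^ 2) : ℝ) : ℂ)))) |x|) := by
    rcases abs_choice x with h | h
    · rw [h]
    · rw [h]
      exact (weilArchTerm_weilTranslate_neg_of_real hreal x).symm
  rw [heq]
  obtain ⟨him, hlo, hhi⟩ := weilArchTerm_translate_psi_offdiag_bounds ε hε |x| h2
  refine ⟨him, abs_le.2 ⟨?_, ?_⟩⟩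
  · -- lower bracket and the weight bound
    have hg : Real.exp ((|x| - 2 * ε) / 2) / (2 * Real.sinh (|x| - 2 * ε)) ≤ 1 / |x| + 1 := by
      refine (archWeight_le_subOffdiag (by linarith)).trans ?_
      have : 1 / (2 * (|x| - 2 * ε)) ≤ 1 / |x| :=
        one_div_le_one_div_of_le hx0 (by linarith)
      linarith
    have := mul_le_mul_of_nonneg_left hg (sq_nonneg (∫ u : ℝ, expNegInvGlue (1 - u ^ 2)))
    linarith
  · -- upper bracket is `≤ 0`
    have hg : 0 ≤ Real.exp ((|x| + 2 * ε) / 2) / (2 * Real.sinh (|x| + 2 * ε)) :=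
      (div_pos (Real.exp_pos _) (mul_pos two_pos (Real.sinh_pos_iff.2 (by linarith)))).le
    have h1 := mul_nonneg (sq_nonneg (∫ u : ℝ, expNegInvGlue (1 - u ^ 2))) hg
    have h3 : 0 ≤ (∫ u : ℝ, expNegInvGlue (1 - u ^ 2)) ^ 2 * (1 / |x| + 1) := by positivity
    linarith

/-! ### The stub -/

/-- **Stub S2 of the effective subcritical window — the signed archimedean off-diagonal form.**
For `ε > 0`, `M`, `a` with `4εM ≤ 1`:
`Re Σ_m Σ_{m' ≠ m} a_m conj a_{m'} W_∞(τ_{log m − log m'} ψ_ε) ≥ −I₀² (B_abs(a) + S₁²)`.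
Each entry is real with `|W_∞(τ_x ψ_ε)| ≤ I₀² (1/|x| + 1)` (`weilArchTerm_translate_psi_entry_bound`,
applicable since `|log m − log m'| ≥ 1/M ≥ 4ε`), and `Σ_{m ≠ m'} ‖a_m‖ ‖a_{m'}‖ ≤ S₁²`. -/
theorem stub_subOffdiag : ∀ ε : ℝ, 0 < ε → ∀ (M : ℕ) (a : ℕ → ℂ), 4 * ε * M ≤ 1 →
    -((∫ u : ℝ, expNegInvGlue (1 - u ^ 2)) ^ 2 *
        ((∑ m ∈ Finset.Icc 1 M, ∑ m' ∈ (Finset.Icc 1 M).erase m,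
            ‖a m‖ * ‖a m'‖ / |Real.log m - Real.log m'|) +
          (∑ m ∈ Finset.Icc 1 M, ‖a m‖) ^ 2)) ≤
      (∑ m ∈ Finset.Icc 1 M, ∑ m' ∈ (Finset.Icc 1 M).erase m,
        a m * conj (a m') *
          weilArchTerm (weilTranslate
            (weilConv (fun t : ℝ => (ε : ℂ)⁻¹ * ((expNegInvGlue (1 - (t / ε) ^ 2) : ℝ) : ℂ))
              (weilReflect (fun t : ℝ => (ε : ℂ)⁻¹ * ((expNegInvGlue (1 - (t / ε) ^ 2) : ℝ) : ℂ))))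
            (Real.log (m : ℝ) - Real.log (m' : ℝ)))).re := by
  intro ε hε M a hεM
  set I0 : ℝ := ∫ u : ℝ, expNegInvGlue (1 - u ^ 2) with hI0
  rw [Complex.re_sum]
  simp_rw [Complex.re_sum]
  -- Step 1: `S₁² ≥ Σ_{m ≠ m'} ‖a_m‖ ‖a_{m'}‖`
  have hS : ∑ m ∈ Finset.Icc 1 M, ∑ m' ∈ (Finset.Icc 1 M).erase m, ‖a m‖ * ‖a m'‖ ≤
      (∑ m ∈ Finset.Icc 1 M, ‖a m‖) ^ 2 := by
    rw [sq, Finset.sum_mul_sum]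
    exact Finset.sum_le_sum fun m _ =>
      Finset.sum_le_sum_of_subset_of_nonneg (Finset.erase_subset _ _)
        fun m' _ _ => mul_nonneg (norm_nonneg _) (norm_nonneg _)
  -- Step 2: the entrywise bound
  have hentry : ∀ m ∈ Finset.Icc 1 M, ∀ m' ∈ (Finset.Icc 1 M).erase m,
      -(I0 ^ 2 * (‖a m‖ * ‖a m'‖ / |Real.log m - Real.log m'| + ‖a m‖ * ‖a m'‖)) ≤
        (a m * conj (a m') *
          weilArchTerm (weilTranslate
            (weilConv (fun t : ℝ => (ε : ℂ)⁻¹ * ((expNegInvGlue (1 - (t / ε) ^ 2) : ℝ) : ℂ))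
              (weilReflect (fun t : ℝ => (ε : ℂ)⁻¹ * ((expNegInvGlue (1 - (t / ε) ^ 2) : ℝ) : ℂ))))
            (Real.log (m : ℝ) - Real.log (m' : ℝ)))).re := by
    intro m hm m' hm'
    have hM0 : (0 : ℝ) < M := by
      have h := Finset.mem_Icc.1 hm
      exact_mod_cast lt_of_lt_of_le h.1 h.2
    have h4 : 4 * ε ≤ |Real.log m - Real.log m'| := by
      refine le_trans ?_ (log_gap_subOffdiag hm hm')
      rwa [le_div_iff₀ hM0]
    obtain ⟨him, habs⟩ := weilArchTerm_translate_psi_entry_bound ε hε _ h4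
    have h := re_mul_ge_of_real_subOffdiag (z := a m * conj (a m')) him habs
    rw [norm_mul, Complex.norm_conj] at h
    convert h using 1
    rw [hI0]
    ring
  -- Step 3: sum up
  calc -(I0 ^ 2 * ((∑ m ∈ Finset.Icc 1 M, ∑ m' ∈ (Finset.Icc 1 M).erase m,
            ‖a m‖ * ‖a m'‖ / |Real.log m - Real.log m'|) + (∑ m ∈ Finset.Icc 1 M, ‖a m‖) ^ 2))
      ≤ -(I0 ^ 2 * ((∑ m ∈ Finset.Icc 1 M, ∑ m' ∈ (Finset.Icc 1 M).erase m,
            ‖a m‖ * ‖a m'‖ / |Real.log m - Real.log m'|) +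
            ∑ m ∈ Finset.Icc 1 M, ∑ m' ∈ (Finset.Icc 1 M).erase m, ‖a m‖ * ‖a m'‖)) := by
        have := mul_le_mul_of_nonneg_left hS (sq_nonneg I0)
        nlinarith
    _ = ∑ m ∈ Finset.Icc 1 M, ∑ m' ∈ (Finset.Icc 1 M).erase m,
          -(I0 ^ 2 * (‖a m‖ * ‖a m'‖ / |Real.log m - Real.log m'| + ‖a m‖ * ‖a m'‖)) := by
        simp only [Finset.sum_neg_distrib, Finset.mul_sum, Finset.sum_add_distrib, mul_add]
    _ ≤ _ := Finset.sum_le_sum fun m hm => Finset.sum_le_sum fun m' hm' => hentry m hm m' hm'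

end Summit.RiemannHypothesis.RiemannHypothesis.Theorems.WeilCombBohrFejer

end
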